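import Summits.QuantumFields.BalabanUV.Beta.FP.GradedIteratedDerivOn
import Summits.QuantumFields.BalabanUV.Beta.FP.MaxwellSymbolDeriv

/-!
# `BalabanUV.Beta.FP.MaxwellSymbolDerivOn` — road «FP» for binder row D1, leaf H2-P, row H2-P-REG (owner ruling R-FP-17), PART 2′: the LOCAL form of
# `FP/MaxwellSymbolDeriv` — the weighted Maxwell ∕ Feynman entries along a coordinate slice are graded of order 4 ∕ 2 when the weight's slices are
# `ContDiffOn ℝ 3` on an OPEN set `U ∋ s i` (the domain of W166-HOLO (D): `|t| < π + δ₀`), with `w − 1` graded of order 2 at `s i`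

HONEST DEPENDENCY (page 1, mandatory): continuum YM on T⁴ ⇐ BetaPertH ∧ nine spine estimates (0/9 proved); BetaPertH ⇐ (D1) ∧ (D4) ∧ CAP+tail;
G-an2-4 gates asym, D1 and NE2/3/4.  HONEST FRAMING (cell contract, verbatim): «discharging `BetaPertH` makes Bałaban's UV stability UNCONDITIONAL —
a real constructive-QFT result; it is NOT the continuum limit and NOT the Clay problem.»  THIS MODULE DISCHARGES NOTHING of the wall: [folklore] one-variable
calculus — the local toolkit `FP/GradedIteratedDerivOn` applied to the atom∕curl∕plaquette lemmas of `FP/MaxwellSymbolDeriv` (p234904, global atoms) with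
the WEIGHT ABSTRACT and its LOCAL regularity displayed (`hU`, `hsi`, `hwC`, `hw`).  0 def; no `def … : Prop`; nothing cited; 0 sorry; NOT D1, NOT BetaPertH,
NOT continuum, NOT Clay.

ABSOLUTE RULE (cell charter, verbatim): «No internally-minted statement may enter as a cited fact. Every hypothesis is either kernel-proved in this package or a
verbatim quotation of a PUBLISHED theorem with page reference. The manuscript(s) under audit are NOT citable for their own disputed steps — they are the thing
under adjudication; programme-internal (2001/route/tribunal) claims are never citable.»

CURRENCY.  `s : Fin d → ℝ` base point, direction `i`, slice `t ↦ Function.update s i t`; `U : Set ℝ` OPEN with `s i ∈ U`; per `μ ν`: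
`hwC : ContDiffOn ℝ 3 (fun t => ((w μ ν (update s i t) : ℝ) : ℂ)) U`, `hw : ∀ n ≤ 3, ‖iteratedDeriv n (fun t => ((w μ ν (update s i t) : ℝ) : ℂ) − 1) (s i)‖ ≤ cw·‖s‖^{2−n}`
(`0 ≤ cw`); `‖s‖ ≤ M`, `1 ≤ M`.
WHAT.  **`graded_excess_entry_on`** (`‖∂ᵢⁿ[maxwellMat (w−1)(d1Sym)]_{γβ}(s)‖ ≤ 128d²M⁶cw·‖s‖^{4−n}`, `n ≤ 3`), **`graded_feyn_entry_on`**
(`≤ (128d²M⁴(M²cw+1) + 8M²)·‖s‖^{2−n}`), `contDiffOn_excess_entry` ∕ `contDiffOn_feyn_entry` (on `U`), **`hasDerivAt_iteratedDeriv_slice_on`** (the chain at every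
`t ∈ U`), with the same constants as the global file.
Provenance: binder row G-an2-4 owner lineage gan24-p3, gen 16 (prover-b2b-balaban-gan24-p3-g16-0), 2026-08-20; supplier of road FP's H2-P-REG (owner
b2b-balaban-beta-d1-p3, R-FP-17); consumers H2-P-INV (gan24-formalise-leaf-01), H2-P-B (gan24-formalise-leaf-05), R2 (this lineage, after W166-HOLO (D)).
-/

noncomputable section

namespace Summit.QuantumFields.BalabanUV.Beta.FP.MaxwellSymbolDerivOn

open Complex Finset
open scoped BigOperators ComplexConjugate
open Literature.MathematicalPhysics.QuantumFieldTheory.Balaban1983to89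
open B5Prop11Fiber (d1Sym)
open Summit.QuantumFields.BalabanUV.Beta.FP.PerfectPropagatorSymbol (curlRow maxwellMat feynMat)
open Summit.QuantumFields.BalabanUV.Beta.FP.GradedIteratedDeriv
open Summit.QuantumFields.BalabanUV.Beta.FP.GradedIteratedDerivOn
open Summit.QuantumFields.BalabanUV.Beta.FP.MaxwellSymbolDeriv

variable {d : ℕ} (w : Fin d → Fin d → (Fin d → ℝ) → ℝ) (s : Fin d → ℝ) (i : Fin d) {U : Set ℝ} {cw M : ℝ}

/-! ## §1 The excess entry: ORDER 4, local hypotheses -/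

/-- [folklore] one plaquette term of the excess entry is `ContDiffOn ℝ 3 · U`. -/
theorem contDiffOn_excess_term (hwC : ∀ μ ν, ContDiffOn ℝ 3 (fun t : ℝ => ((w μ ν (Function.update s i t) : ℝ) : ℂ)) U) (μ ν γ β : Fin d) :
    ContDiffOn ℝ 3 (fun t : ℝ => (1 / 2 : ℂ) * ((((w μ ν (Function.update s i t) : ℝ) : ℂ) - 1)
      * (conj (curlRow (d1Sym (Function.update s i t)) μ ν γ) * curlRow (d1Sym (Function.update s i t)) μ ν β))) U :=
  contDiffOn_const.mul (((hwC μ ν).sub contDiffOn_const).mul (contDiff_plaq_slice s i μ ν γ β).contDiffOn)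

/-- [folklore] the excess entry slice is `ContDiffOn ℝ 3 · U`. -/
theorem contDiffOn_excess_entry (hwC : ∀ μ ν, ContDiffOn ℝ 3 (fun t : ℝ => ((w μ ν (Function.update s i t) : ℝ) : ℂ)) U) (γ β : Fin d) :
    ContDiffOn ℝ 3 (fun t : ℝ => maxwellMat (fun μ ν => w μ ν (Function.update s i t) - 1) (d1Sym (Function.update s i t)) γ β) U := by
  rw [excess_slice_eq]
  exact ContDiffOn.sum fun μ _ => ContDiffOn.sum fun ν _ => contDiffOn_excess_term w s i hwC μ ν γ β

/-- [folklore] one plaquette term of the excess entry is graded `(4, 128·M⁶·cw)` under the local hypotheses. -/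
theorem graded_excess_term_on (hU : IsOpen U) (hsi : s i ∈ U)
    (hwC : ∀ μ ν, ContDiffOn ℝ 3 (fun t : ℝ => ((w μ ν (Function.update s i t) : ℝ) : ℂ)) U)
    (hcw : 0 ≤ cw) (hw : ∀ μ ν, ∀ n ≤ 3, ‖iteratedDeriv n (fun t : ℝ => ((w μ ν (Function.update s i t) : ℝ) : ℂ) - 1) (s i)‖ ≤ cw * ‖s‖ ^ (2 - n))
    (hsM : ‖s‖ ≤ M) (hM : 1 ≤ M) (μ ν γ β : Fin d) :
    ∀ n ≤ 3, ‖iteratedDeriv n (fun t : ℝ => (1 / 2 : ℂ) * ((((w μ ν (Function.update s i t) : ℝ) : ℂ) - 1)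
      * (conj (curlRow (d1Sym (Function.update s i t)) μ ν γ) * curlRow (d1Sym (Function.update s i t)) μ ν β))) (s i)‖
        ≤ 128 * M ^ 6 * cw * ‖s‖ ^ (4 - n) := by
  have hM0 : 0 ≤ M := zero_le_one.trans hM
  have hwC' : ContDiffOn ℝ 3 (fun t : ℝ => ((w μ ν (Function.update s i t) : ℝ) : ℂ) - 1) U := (hwC μ ν).sub contDiffOn_const
  have hprod := graded_mul_on hU hsi hwC' (contDiff_plaq_slice s i μ ν γ β).contDiffOn hcw (by positivity) (hw μ ν)
    (graded_plaq_slice s i μ ν γ β hsM hM) (norm_nonneg s) hsM hM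
  have h := graded_const_mul_on hU hsi (hwC'.mul (contDiff_plaq_slice s i μ ν γ β).contDiffOn) hprod (1 / 2 : ℂ)
  intro n hn
  have := h n hn
  have e : ‖(1 / 2 : ℂ)‖ = 1 / 2 := by simp
  calc _ ≤ ‖(1 / 2 : ℂ)‖ * (8 * M ^ (2 + 2) * cw * (32 * M ^ 2)) * ‖s‖ ^ (2 + 2 - n) := this
    _ = 128 * M ^ 6 * cw * ‖s‖ ^ (4 - n) := by rw [e, show (2 + 2 : ℕ) = 4 from rfl]; ring

/-- [our object] **THE EXCESS WEIGHTED MAXWELL ENTRY IS GRADED OF ORDER 4 — LOCAL FORM**: `U` open, `s i ∈ U`, weight slices `ContDiffOn ℝ 3 · U` with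
`w − 1` graded `(2, cw)` at `s i`, `‖s‖ ≤ M`, `1 ≤ M` ⟹ `‖∂ᵢⁿ [maxwellMat (w − 1) (p̂)]_{γβ} (s)‖ ≤ 128·d²·M⁶·cw · ‖s‖^{4−n}`, `n ≤ 3`. -/
theorem graded_excess_entry_on (hU : IsOpen U) (hsi : s i ∈ U)
    (hwC : ∀ μ ν, ContDiffOn ℝ 3 (fun t : ℝ => ((w μ ν (Function.update s i t) : ℝ) : ℂ)) U)
    (hcw : 0 ≤ cw) (hw : ∀ μ ν, ∀ n ≤ 3, ‖iteratedDeriv n (fun t : ℝ => ((w μ ν (Function.update s i t) : ℝ) : ℂ) - 1) (s i)‖ ≤ cw * ‖s‖ ^ (2 - n))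
    (hsM : ‖s‖ ≤ M) (hM : 1 ≤ M) (γ β : Fin d) :
    ∀ n ≤ 3, ‖iteratedDeriv n (fun t : ℝ => maxwellMat (fun μ ν => w μ ν (Function.update s i t) - 1) (d1Sym (Function.update s i t)) γ β) (s i)‖
      ≤ 128 * d ^ 2 * M ^ 6 * cw * ‖s‖ ^ (4 - n) := by
  rw [excess_slice_eq]
  have hinner : ∀ μ : Fin d, ∀ n ≤ 3, ‖iteratedDeriv n (fun t : ℝ => ∑ ν, (1 / 2 : ℂ) * ((((w μ ν (Function.update s i t) : ℝ) : ℂ) - 1)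
      * (conj (curlRow (d1Sym (Function.update s i t)) μ ν γ) * curlRow (d1Sym (Function.update s i t)) μ ν β))) (s i)‖
        ≤ (∑ _ν : Fin d, 128 * M ^ 6 * cw) * ‖s‖ ^ (4 - n) :=
    fun μ => graded_sum_on hU hsi (Finset.univ : Finset (Fin d)) (fun ν _ => contDiffOn_excess_term w s i hwC μ ν γ β)
      (fun ν _ => graded_excess_term_on w s i hU hsi hwC hcw hw hsM hM μ ν γ β)
  have h := graded_sum_on hU hsi (Finset.univ : Finset (Fin d)) (fun μ _ => ContDiffOn.sum fun ν _ => contDiffOn_excess_term w s i hwC μ ν γ β)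
    (fun μ _ => hinner μ)
  intro n hn
  refine (h n hn).trans (le_of_eq ?_)
  simp only [Finset.sum_const, Finset.card_univ, Fintype.card_fin, nsmul_eq_mul]
  ring

/-! ## §2 The Feynman-completed entry: ORDER 2, local hypotheses -/

/-- [folklore] the weight slice itself is graded `(0, M²cw + 1)` (local form). -/
theorem graded_weight_slice_on (hU : IsOpen U) (hsi : s i ∈ U)
    (hwC : ∀ μ ν, ContDiffOn ℝ 3 (fun t : ℝ => ((w μ ν (Function.update s i t) : ℝ) : ℂ)) U)
    (hcw : 0 ≤ cw) (hw : ∀ μ ν, ∀ n ≤ 3, ‖iteratedDeriv n (fun t : ℝ => ((w μ ν (Function.update s i t) : ℝ) : ℂ) - 1) (s i)‖ ≤ cw * ‖s‖ ^ (2 - n))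
    (hsM : ‖s‖ ≤ M) (hM : 1 ≤ M) (μ ν : Fin d) :
    ∀ n ≤ 3, ‖iteratedDeriv n (fun t : ℝ => ((w μ ν (Function.update s i t) : ℝ) : ℂ)) (s i)‖ ≤ (M ^ 2 * cw + 1) * ‖s‖ ^ (0 - n) := by
  have h1 := graded_of_le_order (hw μ ν) hcw (Nat.zero_le 2) (norm_nonneg s) hsM hM
  have h2 := graded_const (1 : ℂ) zero_le_one (norm_nonneg s) (by simp : ‖(1 : ℂ)‖ ≤ 1 * ‖s‖ ^ 0) (s i)
  have h := graded_add_on hU hsi ((hwC μ ν).sub contDiffOn_const) contDiffOn_const h1 h2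
  have e : (fun t : ℝ => (((w μ ν (Function.update s i t) : ℝ) : ℂ) - 1) + (1 : ℂ)) = fun t : ℝ => ((w μ ν (Function.update s i t) : ℝ) : ℂ) := by
    funext t; ring
  rw [e] at h
  simpa using h

/-- [folklore] one plaquette term of the Feynman entry is `ContDiffOn ℝ 3 · U`. -/
theorem contDiffOn_feyn_term (hwC : ∀ μ ν, ContDiffOn ℝ 3 (fun t : ℝ => ((w μ ν (Function.update s i t) : ℝ) : ℂ)) U) (μ ν γ β : Fin d) :
    ContDiffOn ℝ 3 (fun t : ℝ => (1 / 2 : ℂ) * ((((w μ ν (Function.update s i t) : ℝ) : ℂ))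
      * (conj (curlRow (d1Sym (Function.update s i t)) μ ν γ) * curlRow (d1Sym (Function.update s i t)) μ ν β))) U :=
  contDiffOn_const.mul ((hwC μ ν).mul (contDiff_plaq_slice s i μ ν γ β).contDiffOn)

/-- [folklore] the Feynman entry slice is `ContDiffOn ℝ 3 · U`. -/
theorem contDiffOn_feyn_entry (hwC : ∀ μ ν, ContDiffOn ℝ 3 (fun t : ℝ => ((w μ ν (Function.update s i t) : ℝ) : ℂ)) U) (γ β : Fin d) :
    ContDiffOn ℝ 3 (fun t : ℝ => feynMat (fun μ ν => w μ ν (Function.update s i t)) (d1Sym (Function.update s i t)) γ β) U := by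
  rw [feyn_slice_eq]
  exact (ContDiffOn.sum fun μ _ => ContDiffOn.sum fun ν _ => contDiffOn_feyn_term w s i hwC μ ν γ β).add (contDiff_slice_term s i γ β).contDiffOn

/-- [folklore] one plaquette term of the Feynman entry is graded `(2, 128·M⁴·(M²cw + 1))` (local form). -/
theorem graded_feyn_term_on (hU : IsOpen U) (hsi : s i ∈ U)
    (hwC : ∀ μ ν, ContDiffOn ℝ 3 (fun t : ℝ => ((w μ ν (Function.update s i t) : ℝ) : ℂ)) U)
    (hcw : 0 ≤ cw) (hw : ∀ μ ν, ∀ n ≤ 3, ‖iteratedDeriv n (fun t : ℝ => ((w μ ν (Function.update s i t) : ℝ) : ℂ) - 1) (s i)‖ ≤ cw * ‖s‖ ^ (2 - n))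
    (hsM : ‖s‖ ≤ M) (hM : 1 ≤ M) (μ ν γ β : Fin d) :
    ∀ n ≤ 3, ‖iteratedDeriv n (fun t : ℝ => (1 / 2 : ℂ) * ((((w μ ν (Function.update s i t) : ℝ) : ℂ))
      * (conj (curlRow (d1Sym (Function.update s i t)) μ ν γ) * curlRow (d1Sym (Function.update s i t)) μ ν β))) (s i)‖
        ≤ 128 * M ^ 4 * (M ^ 2 * cw + 1) * ‖s‖ ^ (2 - n) := by
  have hM0 : 0 ≤ M := zero_le_one.trans hM
  have hprod := graded_mul_on hU hsi (hwC μ ν) (contDiff_plaq_slice s i μ ν γ β).contDiffOn (by positivity) (by positivity)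
    (graded_weight_slice_on w s i hU hsi hwC hcw hw hsM hM μ ν) (graded_plaq_slice s i μ ν γ β hsM hM) (norm_nonneg s) hsM hM
  have h := graded_const_mul_on hU hsi ((hwC μ ν).mul (contDiff_plaq_slice s i μ ν γ β).contDiffOn) hprod (1 / 2 : ℂ)
  intro n hn
  have := h n hn
  have e : ‖(1 / 2 : ℂ)‖ = 1 / 2 := by simp
  calc _ ≤ ‖(1 / 2 : ℂ)‖ * (8 * M ^ (0 + 2) * (M ^ 2 * cw + 1) * (32 * M ^ 2)) * ‖s‖ ^ (0 + 2 - n) := this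
    _ = 128 * M ^ 4 * (M ^ 2 * cw + 1) * ‖s‖ ^ (2 - n) := by rw [e, show (0 + 2 : ℕ) = 2 from rfl]; ring

/-- [our object] **THE FEYNMAN-COMPLETED WEIGHTED MAXWELL ENTRY IS GRADED OF ORDER 2 — LOCAL FORM**: under the local weight hypotheses,
`‖∂ᵢⁿ [feynMat w (p̂)]_{γβ} (s)‖ ≤ (128·d²·M⁴·(M²cw + 1) + 8M²) · ‖s‖^{2−n}` for `n ≤ 3`. -/
theorem graded_feyn_entry_on (hU : IsOpen U) (hsi : s i ∈ U)
    (hwC : ∀ μ ν, ContDiffOn ℝ 3 (fun t : ℝ => ((w μ ν (Function.update s i t) : ℝ) : ℂ)) U)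
    (hcw : 0 ≤ cw) (hw : ∀ μ ν, ∀ n ≤ 3, ‖iteratedDeriv n (fun t : ℝ => ((w μ ν (Function.update s i t) : ℝ) : ℂ) - 1) (s i)‖ ≤ cw * ‖s‖ ^ (2 - n))
    (hsM : ‖s‖ ≤ M) (hM : 1 ≤ M) (γ β : Fin d) :
    ∀ n ≤ 3, ‖iteratedDeriv n (fun t : ℝ => feynMat (fun μ ν => w μ ν (Function.update s i t)) (d1Sym (Function.update s i t)) γ β) (s i)‖
      ≤ (128 * d ^ 2 * M ^ 4 * (M ^ 2 * cw + 1) + 8 * M ^ 2) * ‖s‖ ^ (2 - n) := by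
  rw [feyn_slice_eq]
  have hinner : ∀ μ : Fin d, ∀ n ≤ 3, ‖iteratedDeriv n (fun t : ℝ => ∑ ν, (1 / 2 : ℂ) * ((((w μ ν (Function.update s i t) : ℝ) : ℂ))
      * (conj (curlRow (d1Sym (Function.update s i t)) μ ν γ) * curlRow (d1Sym (Function.update s i t)) μ ν β))) (s i)‖
        ≤ (∑ _ν : Fin d, 128 * M ^ 4 * (M ^ 2 * cw + 1)) * ‖s‖ ^ (2 - n) :=
    fun μ => graded_sum_on hU hsi (Finset.univ : Finset (Fin d)) (fun ν _ => contDiffOn_feyn_term w s i hwC μ ν γ β)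
      (fun ν _ => graded_feyn_term_on w s i hU hsi hwC hcw hw hsM hM μ ν γ β)
  have hS := graded_sum_on hU hsi (Finset.univ : Finset (Fin d)) (fun μ _ => ContDiffOn.sum fun ν _ => contDiffOn_feyn_term w s i hwC μ ν γ β)
    (fun μ _ => hinner μ)
  have h := graded_add_on hU hsi (ContDiffOn.sum fun μ _ => ContDiffOn.sum fun ν _ => contDiffOn_feyn_term w s i hwC μ ν γ β)
    (contDiff_slice_term s i γ β).contDiffOn hS (graded_slice_term s i hsM hM γ β)
  intro n hn
  refine (h n hn).trans (le_of_eq ?_)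
  simp only [Finset.sum_const, Finset.card_univ, Fintype.card_fin, nsmul_eq_mul]
  ring

/-! ## §3 The chain along a slice from local regularity -/

/-- [folklore] **THE CHAIN, LOCAL FORM**: if the slice `t ↦ G (update s i t)` is `ContDiffOn ℝ 3` on an open `U` then for `j < 3` and every `t ∈ U` the
`j`-th slice derivative has the `(j+1)`-st as its derivative at `t`. -/
theorem hasDerivAt_iteratedDeriv_slice_on {G : (Fin d → ℝ) → ℂ} {s : Fin d → ℝ} {i : Fin d} {U : Set ℝ} (hU : IsOpen U)
    (hG : ContDiffOn ℝ 3 (fun t : ℝ => G (Function.update s i t)) U) {j : ℕ} (hj : j < 3) {t : ℝ} (ht : t ∈ U) :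
    HasDerivAt (iteratedDeriv j (fun u : ℝ => G (Function.update s i u)))
      (iteratedDeriv (j + 1) (fun u : ℝ => G (Function.update s i u)) t) t :=
  hasDerivAt_iteratedDeriv_on hU hG hj ht

end Summit.QuantumFields.BalabanUV.Beta.FP.MaxwellSymbolDerivOn

end
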